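import Summits.BirchSwinnertonDyer.BirchSwinnertonDyer.Theorems.SemiOrdinaryEisensteinDescentWildSplitEisensteinValueAtOneVPTFree
import Summits.BirchSwinnertonDyer.BirchSwinnertonDyer.Theorems.SemiOrdinaryEisensteinDescentWildSplitEisensteinValueAtOneVIndexKolyvagin
import Summits.BirchSwinnertonDyer.BirchSwinnertonDyer.Theorems.ClassRecordThreeEulerHalvesAtThreeRefinedKolyvaginOfBSD
import Literature.NumberTheory.EllipticCurves.MatarNekovar2019.ShaStructureIrreducible
import Summits.BirchSwinnertonDyer.BirchSwinnertonDyer.Theorems.WildSigmaDivisibilityAtThreeMultiCarrier.Negative.MinfFormAndCertificateShape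
import HarnessLib

/-!
# Route `SemiOrdinaryEisensteinDescent` (SOED), crux #2″ of record `WildSplitEisensteinValueAtOneV`
# (stmt-BirchSwinnertonDyer-26610, `E_𝟙^V`), registered line `index` (v3, 6d772f56a67e5096): the `M_∞` CURRENCY —
# modulo PRINT, crux #2″ is EXACTLY the `≤`-half of the refined Kolyvagin conjecture at the wild `3`,
# «`M_∞(E, K, 3) ≤ ord₃(c·∏_ℓ c_ℓ(E))` at every odd Friedberg–Hoffstein datum of the O6 onto `r₁` cell»
# (cell `pub/bsd-wall`, width seat `bsd-wall-soed-p1-w3` g18, `--supports stmt-BirchSwinnertonDyer-26610`, helper;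
# no definition, no named fact minted, no `sorry`)

WHY. Modulo print the E-lineage reads the crux of record as the index inequality `I_FH` (p632342 `valueAtOneV_iff_indexLowerBoundFH`,
mod {PUB 20389, W 24476}); the certificate roads p621234 / p623400 give `I_FH` FROM one Kolyvagin point-certificate per datum. Missing
was the CONVERSE in that currency. The tree holds both one-sided readings of Kolyvagin's structure theorem `#Ш(E/K)[p^∞] =
p^{2(M₀ − M_∞)}` under IRREDUCIBILITY of `ρ̄_{E,p}` with NO reduction binder at `p` (Matar–Nekovář 2019 Thm. 0.7 / §0.11: named
facts `MatarNekovar2019.thm07_pow_dvd_card_sha_primary_of_certificate_of_irreducible` (lower) and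
`MatarNekovar2019.thm07_padicValNat_card_sha_primary_add_le_of_globalDivisibility_of_irreducible` (upper) = the route's aside
`MatarNekovarShaStructure`, item 20446) and McCallum's invariants ON THE TREE'S OBJECTS (`Koly.Minf Dt β ι p = M_∞`,
`Koly.CertificateAt`; cells x11b3 / tam3). This file closes the circle on the wild cell, with NO `3`-adic tower hypothesis:

* §0 `fhFrame` — bookkeeping at ONE Friedberg–Hoffstein datum (non-CM, `ρ̄₃` irreducible, `d_K ∉ {−3, −4}`, rank one and `Ш(E/K)`
  finite (Kolyvagin), conductor-`1` datum with bottom point `P`, `3^{M₀} ∥ P`, `ord₃[E(K):ℤP] = M₀`, `ord₃ #Ш = ord₃ #Ш[3^∞]`).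
* §1 POINTWISE: `indexLowerBoundLeAt_FH_of_minf_le` (`M_∞ ≤ t+s ⟹ I_FH`: `M_∞ = u` is attained, `Koly.certificateAt_of_minf_eq`, and
  MN19-lower gives `3^{2(M₀−u)} ∣ #Ш`); `minf_le_of_indexLowerBoundLeAt_FH` (`I_FH ⟹ M_∞ ≤ t+s`: else global divisibility to
  depth `t+s+1`, `Koly.globalDivisibility_iff_le_minf`, and MN19-upper gives `ord₃ #Ш[3^∞] + 2(t+s+1) ≤ 2M₀`); the `iff`; and
  `exists_certificateAt_of_indexLowerBoundLeAt_FH`. Here `t = ord₃ ∏_ℓ c_ℓ(E)`, `s = v₃(c(Dt))`.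
* §2 CLASS-WIDE: `valueAtOneV_of_minfLeFH_of_kolyvagin` (`Kolyvagin → MN19-lower → RKC₃^FH,≤ → E_𝟙^V`, via p632995);
  `minfLeFH_of_valueAtOneV` (`PUB → W → MN19-upper → E_𝟙^V → RKC₃^FH,≤`); **`valueAtOneV_iff_minfLeFH`: modulo PRINT ONLY,
  `E_𝟙^V ↔ RKC₃^FH,≤`** (displayed, no definition: at every datum of `I_FH`'s binders, `Koly.Minf Dt H.β ι 3 ≤ ord₃∏c_ℓ + v₃(c)`).
* §3 the rung `↔ RKC₃^FH,≤` modulo the route's `closes` content; §4 `minf_eq_of_valueAtOneV_of_sigmaMultiCarrier`: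
  **`E_𝟙^V ∧ J‴ ⟹ M_∞ = ord₃∏c_ℓ + v₃(c)` EXACTLY** on every cut multi-carrier frame (J‴ = item 25898, the `≥`-half).

READING. Crux #2″'s research content is a statement about HEEGNER POINTS ONLY (no Λ, no BDP frame, no `p`-adic `L`, no `#Ш`):
«at every odd FH datum of the cell some derived point `P_n`, `n ∈ S_r(u+1)`, is not `3^{u+1}`-divisible in `E(K[n])` for some
`u ≤ ord₃(c·∏c_ℓ)`» — the `≤`-half of the refined Kolyvagin conjecture (W. Zhang 2014 Rem. 18; BCGS Thm. 2 at `p ∤ 6N`;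
arXiv:2601.14504 Thm. 3 at `p > 3` good ordinary ⟺ HPMC; nothing at an additive `3`, where BD-admissible primes do not exist).
Disprover's target: ONE odd FH datum with `ord₃[E(K):ℤy_K] > ord₃(c∏c_ℓ)` all of whose derived points `P_n`, `n ∈ S_r(s′)`,
`s′ ≤ ord₃(c∏c_ℓ) + 1`, are `3^{s′}`-divisible.

HONEST FRAMING: theorems only; every crux, package and named fact is a HYPOTHESIS; nothing asserted about any curve; closes nothing;
`E_𝟙^V`, `I_FH`, `RKC₃^FH,≤` stay OPEN; BSD₃ is proved for no curve. No definition, no named fact, no `sorry`.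

References: [MatarNekovar2019] Thm. 0.7, §0.11; [McCallumLMS1991] §4 `S_r(M)`, §5 Lemma 5.1, Thm. 5.4, Cor. 5.6; [Kolyvagin1990]
Thm. A; [WZhang2014] Thm. 1.1, Rem. 18, Thm. 10.2; [Jetchev2008] Conj. 1.3, Thm. 1.4; [BurungaleEtAl2026] Thm. 2;
[JetchevSkinnerWan2017] §7.4.1; [GrossLMS1991] §4 (4.1), Lemma 4.3; [Darmon2004] Thm. 3.6–3.7; [FriedbergHoffstein1995] Thm. B.
-/

noncomputable section

open scoped Classical NumberField

set_option linter.dupNamespace false -- `Summit.BirchSwinnertonDyer.BirchSwinnertonDyer.Theorems.…` (summit = sub, D-0017)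
set_option autoImplicit false

namespace Summit.BirchSwinnertonDyer.BirchSwinnertonDyer.Theorems.WildSplitEisensteinValueAtOneVMinfCurrency

open WeierstrassCurve NumberField IsDedekindDomain Field
  Literature.NumberTheory.EllipticCurves
  Literature.NumberTheory.EllipticCurves.ModularForms
  Literature.NumberTheory.EllipticCurves.Rank1Residual
  Literature.NumberTheory.GaloisCohomology
  Summit.BirchSwinnertonDyer.Rank1Residual
  Summit.BirchSwinnertonDyer.Rank1Residual.Additive
  Summit.BirchSwinnertonDyer.Rank1Residual.X11b
  Summit.BirchSwinnertonDyer.Rank1Residual.X11b.Three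
  Summit.BirchSwinnertonDyer.BirchSwinnertonDyer.Theses.SemiOrdinaryEisensteinDescent
  Summit.BirchSwinnertonDyer.BirchSwinnertonDyer.Theorems

/-! ### §0 The frame of ONE Friedberg–Hoffstein datum of the cell (bookkeeping, packaged once) -/

/-- **The McCallum frame of an FH datum of the O6 onto cell.** For `W/ℚ` globally minimal on `ClassO6 W 3` with `ρ̄_{E,3}` onto, `K`
imaginary quadratic Heegner for `N_E` with `d_K` odd, `(Dt, H, ι)` at level `N_E` and `P ∈ E(K)` with `ι(P) = heegnerPointComplex Dt H` of
infinite order, GIVEN Kolyvagin's theorem (`hKo`, named fact): non-CM and `ρ̄_{E,3}` irreducible; `d_K ≠ −3` (the additive `3 ∣ N_E` splits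
in `K`) and `d_K ≠ −4`; `Ш(E/K)` finite with `ord₃ #Ш = ord₃ #Ш[3^∞]`; a conductor-`1` Kolyvagin–Heegner datum `d₁` on `(Dt, H.β, ι)` with
bottom point `P` (Darmon Thm. 3.6 + Shimura reciprocity, tree theorems); `M₀` with `3^{M₀} ∥ P` in `E(K)` and `ord₃[E(K):ℤP] = M₀` (McCallum
Lemma 5.1; `E(K)[3] = 0`, rank one) — w3 g5's `lower_of_certificate` steps, packaged. CONDITIONAL on `hKo`.
[cite: McCallumLMS1991, §5 Lemma 5.1 (p. 303)] [cite: GrossLMS1991, §4 (4.1) and Lemma 4.3] [cite: Darmon2004, Thm. 3.6–3.7] [cite: Kolyvagin1990, Thm. A] -/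
theorem fhFrame
    (hKo : ∀ (N : ℕ) [NeZero N] (W : WeierstrassCurve ℚ) (K : Type) [Field K] [NumberField K], kolyvagin N W K)
    (W : WeierstrassCurve ℚ) [W.IsElliptic] [W.IsGloballyMinimal] [NeZero (W.conductorNorm ℤ)]
    (K : Type) [Field K] [NumberField K]
    (Dt : ModularParametrizationData W (W.conductorNorm ℤ)) (H : HeegnerDatum (W.conductorNorm ℤ) (NumberField.discr K))
    (ι : K →+* ℂ) (P : (W.baseChange K).toAffine.Point)
    (hO6 : Additive.ClassO6 W 3) (hsurj : W.HasSurjectiveModNGaloisRep 3)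
    (hK : IsImaginaryQuadratic K) (hHH : SatisfiesHeegnerHypothesis (W.conductorNorm ℤ) K)
    (hP : WeierstrassCurve.Affine.Point.map ι.toRatAlgHom P = heegnerPointComplex Dt H)
    (hnt : ¬ IsOfFinAddOrder P) (hodd : Odd (NumberField.discr K)) :
    ¬ W.HasCM ∧ W.HasIrreducibleModPGaloisRep 3 ∧ NumberField.discr K ≠ -3 ∧ NumberField.discr K ≠ -4 ∧
      Finite (W.baseChange K).sha ∧
      padicValNat 3 (W.baseChange K).shaOrder =
        padicValNat 3 (Nat.card (AddCommGroup.primaryComponent (W.baseChange K).sha 3)) ∧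
      ∃ (d₁ : KolyvaginHeegnerData Dt H.β ι 1) (M₀ : ℕ),
        d₁.toGeomPoints d₁.derivedPoint = toGeomPoints (W.baseChange K) P ∧
        (∃ Q : (W.baseChange K).toAffine.Point, ((3 ^ M₀ : ℕ) : ℤ) • Q = P) ∧
        (¬ ∃ Q : (W.baseChange K).toAffine.Point, ((3 ^ (M₀ + 1) : ℕ) : ℤ) • Q = P) ∧
        padicValNat 3 (AddSubgroup.zmultiples P).index = M₀ := by
  haveI hp3 : Fact (Nat.Prime 3) := ⟨Nat.prime_three⟩
  -- `d_K ≠ -4`: `d_K` is odd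
  have hd4 : NumberField.discr K ≠ -4 := by
    intro h
    have h2 := Int.odd_iff.mp hodd
    omega
  -- `3 ∣ N(E)` (additive at `3`) splits in `K`; hence `d_K ≠ -3`
  have h3N : 3 ∣ W.conductorNorm ℤ :=
    (W.dvd_conductorNorm_iff_not_hasGoodReductionAtPrime 3).mpr (not_good_of_addv W 3 hO6.2.1)
  have hd3 : NumberField.discr K ≠ -3 := by
    intro h
    exact Literature.SatisfiesHeegnerHypothesis.not_dvd_discr hK.1 hHH Nat.prime_three h3N (by rw [h]; norm_num)
  -- mod-`3` image onto, hence irreducible and non-CM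
  have hCM : ¬ W.HasCM := fun hCM ↦
    W.not_hasSurjectiveModNGaloisRep_of_hasCM hCM Nat.prime_three (by decide) hsurj
  haveI : NeZero ((3 : ℕ) : ℚ) := ⟨by norm_num⟩
  have hirr : W.HasIrreducibleModPGaloisRep 3 :=
    hasIrreducibleModPGaloisRep_of_hasSurjectiveModNGaloisRep W 3 hsurj
  -- rank one and `Ш(E/K)` finite (Kolyvagin)
  obtain ⟨hrank, hfin⟩ := hKo (W.conductorNorm ℤ) W K hK hHH ⟨Dt, H, ι, hP⟩ hnt
  haveI : Finite (W.baseChange K).sha := hfin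
  -- no `3`-torsion in `E(K)`
  have hbot := torsionBy_eq_bot_of_isImaginaryQuadratic_of_hasIrreducibleModPGaloisRep W K hK Nat.prime_three hirr
  have hiv : ∀ x : (W.baseChange K).toAffine.Point, 3 • x = 0 → x = 0 := fun x hx ↦ by
    have hmem : x ∈ AddSubgroup.torsionBy (W.baseChange K).toAffine.Point ((3 : ℕ) : ℤ) := by
      rw [mem_torsionBy_iff, natCast_zsmul]
      exact hx
    rw [hbot] at hmem
    exact hmem
  -- the conductor-`1` Kolyvagin–Heegner datum on the frame `(Dt, H.β, ι)` (Darmon 2004, Thm. 3.6)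
  obtain ⟨d₁⟩ := exists_kolyvaginHeegnerData_one
    (phi_heegnerTau_mem_singularModuliField_holds (W.conductorNorm ℤ) W K) hK Dt H.β ι H.dvd_sq_sub
  -- its bottom point is `P` in `E(K̄)` (Shimura reciprocity at conductor `1`)
  have hPd : d₁.toGeomPoints d₁.derivedPoint = toGeomPoints (W.baseChange K) P :=
    KolyvaginBottom.toGeomPoints_derivedPoint_one_eq
      (heegnerPointOfConductor_one_galoisConj_holds (W.conductorNorm ℤ) W K) hK hHH hP d₁ rfl
  -- `3^{M₀} ∥ P` (Mordell–Weil)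
  haveI : Module.Finite ℤ (W.baseChange K).toAffine.Point := (W.baseChange K).module_finite_point_holds
  obtain ⟨M₀, x₀, hx₀, hmax⟩ := exists_pow_smul_eq_and_forall_ne hnt (p := 3) (by norm_num)
  have hdiv : ∃ Q : (W.baseChange K).toAffine.Point, ((3 ^ M₀ : ℕ) : ℤ) • Q = P :=
    ⟨x₀, by rw [natCast_zsmul]; exact hx₀⟩
  have hndiv : ¬ ∃ Q : (W.baseChange K).toAffine.Point, ((3 ^ (M₀ + 1) : ℕ) : ℤ) • Q = P := by
    rintro ⟨Q, hQ⟩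
    exact hmax Q (by rw [← natCast_zsmul]; exact hQ)
  -- `ord₃ #Ш = ord₃ #Ш[3^∞]` and `ord₃ [E(K):ℤP] = M₀`
  have hsha : padicValNat 3 (W.baseChange K).shaOrder =
      padicValNat 3 (Nat.card (AddCommGroup.primaryComponent (W.baseChange K).sha 3)) :=
    Koly.padicValNat_shaOrder_eq (W.baseChange K) 3
  haveI : Finite (AddCommGroup.torsion (W.baseChange K).toAffine.Point) :=
    WeierstrassCurve.finite_torsion_point (W := W.baseChange K)
  obtain ⟨c, Q, hcQ, hcker⟩ := RankOne.exists_coord_of_mordellWeilRank_eq_one (W.baseChange K) hrank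
  have hidx : padicValNat 3 (AddSubgroup.zmultiples P).index = M₀ :=
    Koly.padicValNat_index_zmultiples_eq_of_divisibility c Q hcQ hcker hiv P hdiv hndiv
  exact ⟨hCM, hirr, hd3, hd4, hfin, hsha, d₁, M₀, hPd, hdiv, hndiv, hidx⟩

/-! ### §1 Pointwise at an FH datum: `I_FH ⟺ M_∞ ≤ ord₃∏c_ℓ + v₃(c)` (Matar–Nekovář Thm. 0.7, both readings; no tower) -/

/-- **`M_∞ ≤ ord₃∏c_ℓ + v₃(c) ⟹ I_FH` at ONE Friedberg–Hoffstein datum of the cell, NO tower hypothesis.** Binders = the registered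
stub `stub_indexLowerBoundFH`'s (free level `N` with `N_E = N`; `r_an = 1` and `L(E^(d_K),1) ≠ 0` are not needed). Inputs: Kolyvagin
(`hKo`, named fact); Matar–Nekovář 2019 Thm. 0.7 in certificate (LOWER) form under irreducibility, no reduction binder at `3` (`hMNL`,
named Literature fact); McCallum's `M_∞` of the frame `(Dt, H.β, ι)` at `3` within the budget `t + s` (`t = ord₃∏c_ℓ(E)`,
`s = v₃(c(Dt))`). Proof: `M_∞ = u ≤ t + s` is ATTAINED (`Koly.certificateAt_of_minf_eq`: some `n ∈ S_r(u+1)` carries a datum with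
`P_n ∉ 3^{u+1}E(K[n])`), the fact gives `3^{2(M₀−u)} ∣ #Ш(E/K)[3^∞]`, and §0 turns it into `2·ord₃[E(K):ℤP] ≤ ord₃ #Ш + 2t + 2s`.
CONDITIONAL on `hKo`, `hMNL`. [cite: MatarNekovar2019, Thm. 0.7 (p. 456) and §0.11 (p. 457)] [cite: McCallumLMS1991, §5 Cor. 5.6, Lemma 5.1] -/
theorem indexLowerBoundLeAt_FH_of_minf_le
    (hKo : ∀ (N : ℕ) [NeZero N] (W : WeierstrassCurve ℚ) (K : Type) [Field K] [NumberField K], kolyvagin N W K)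
    (hMNL : MatarNekovar2019.thm07_pow_dvd_card_sha_primary_of_certificate_of_irreducible)
    (W : WeierstrassCurve ℚ) [W.IsElliptic] [W.IsGloballyMinimal] (N : ℕ) [NeZero N]
    (K : Type) [Field K] [NumberField K]
    (Dt : ModularParametrizationData W N) (H : HeegnerDatum N (NumberField.discr K)) (ι : K →+* ℂ)
    (P : (W.baseChange K).toAffine.Point)
    (hO6 : Additive.ClassO6 W 3) (hsurj : W.HasSurjectiveModNGaloisRep 3) (hN : W.conductorNorm ℤ = N)
    (hK : IsImaginaryQuadratic K) (hHH : SatisfiesHeegnerHypothesis N K)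
    (hP : WeierstrassCurve.Affine.Point.map ι.toRatAlgHom P = heegnerPointComplex Dt H)
    (hnt : ¬ IsOfFinAddOrder P) (hodd : Odd (NumberField.discr K))
    (hmin : Koly.Minf Dt H.β ι 3 ≤ ((padicValNat 3 W.tamagawaProduct + padicValNat 3 Dt.c.natAbs : ℕ) : ℕ∞)) :
    SchneiderFree.IndexLowerBoundLeAt W 3 K P (padicValNat 3 Dt.c.natAbs) := by
  subst hN
  haveI hp3 : Fact (Nat.Prime 3) := ⟨Nat.prime_three⟩
  obtain ⟨hCM, hirr, hd3, hd4, hfin, hsha, d₁, M₀, hPd, hdiv, hndiv, hidx⟩ :=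
    fhFrame hKo W K Dt H ι P hO6 hsurj hK hHH hP hnt hodd
  haveI : Finite (W.baseChange K).sha := hfin
  -- `M_∞` is finite: `M_∞ = u` with `u ≤ t + s`
  have htop : Koly.Minf Dt H.β ι 3 ≠ ⊤ := ne_top_of_le_ne_top (ENat.coe_ne_top _) hmin
  obtain ⟨u, hu⟩ := ENat.ne_top_iff_exists.mp htop
  have hu' : Koly.Minf Dt H.β ι 3 = (u : ℕ∞) := hu.symm
  have huB : u ≤ padicValNat 3 W.tamagawaProduct + padicValNat 3 Dt.c.natAbs := by
    rw [hu'] at hmin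
    exact_mod_cast hmin
  -- the infimum is attained: a level-`(u+1)` certificate
  obtain ⟨n, r, d, hmem, hnd⟩ := Koly.certificateAt_of_minf_eq Dt H.β ι 3 hu'
  -- Matar–Nekovář Thm. 0.7, certificate (lower) form, at level `u + 1`
  have hnd' : ¬ ∃ Q : (W.baseChange (ringClassField K ι n)).toAffine.Point,
      ((3 ^ (u + 1) : ℕ) : ℤ) • Q = d.derivedPoint := hnd
  have hdvd := hMNL W hCM K hK hd3 hd4 hHH 3 (by decide) hirr Dt H.β ι d₁ P hPd hnt M₀ hdiv hndiv n u d hmem.1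
    hmem.2.2 hnd'
  have hpos : Nat.card (AddCommGroup.primaryComponent (W.baseChange K).sha 3) ≠ 0 := Nat.card_pos.ne'
  have hle : 2 * (M₀ - u) ≤ padicValNat 3 (Nat.card (AddCommGroup.primaryComponent (W.baseChange K).sha 3)) :=
    (padicValNat_dvd_iff_le hpos).mp hdvd
  unfold SchneiderFree.IndexLowerBoundLeAt
  rw [hidx, hsha]
  omega

/-- **`I_FH ⟹ M_∞ ≤ ord₃∏c_ℓ + v₃(c)` at ONE Friedberg–Hoffstein datum of the cell, NO tower hypothesis** — the converse. Inputs: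
Kolyvagin (`hKo`); Matar–Nekovář 2019 Thm. 0.7 in global-divisibility (UPPER) form under irreducibility, no reduction binder at `3`
(`hMNU`, named Literature fact; = the route's aside `MatarNekovarShaStructure`, item 20446); `I_FH` at the datum. Proof: if
`M_∞ > t + s` then every derived point `P_n`, `n ∈ S_r(s′)`, `s′ ≤ t + s + 1`, is `3^{s′}`-divisible (`Koly.globalDivisibility_iff_le_minf`),
so the fact gives `ord₃ #Ш(E/K)[3^∞] + 2(t+s+1) ≤ 2M₀`, while `I_FH` with §0 reads `2M₀ ≤ ord₃ #Ш[3^∞] + 2t + 2s`. CONDITIONAL.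
[cite: MatarNekovar2019, Thm. 0.7 (p. 456) and §0.11 (p. 457)] [cite: McCallumLMS1991, §5 Cor. 5.6 (p. 310) and the definition of M_r (p. 303)] -/
theorem minf_le_of_indexLowerBoundLeAt_FH
    (hKo : ∀ (N : ℕ) [NeZero N] (W : WeierstrassCurve ℚ) (K : Type) [Field K] [NumberField K], kolyvagin N W K)
    (hMNU : MatarNekovar2019.thm07_padicValNat_card_sha_primary_add_le_of_globalDivisibility_of_irreducible)
    (W : WeierstrassCurve ℚ) [W.IsElliptic] [W.IsGloballyMinimal] (N : ℕ) [NeZero N]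
    (K : Type) [Field K] [NumberField K]
    (Dt : ModularParametrizationData W N) (H : HeegnerDatum N (NumberField.discr K)) (ι : K →+* ℂ)
    (P : (W.baseChange K).toAffine.Point)
    (hO6 : Additive.ClassO6 W 3) (hsurj : W.HasSurjectiveModNGaloisRep 3) (hN : W.conductorNorm ℤ = N)
    (hK : IsImaginaryQuadratic K) (hHH : SatisfiesHeegnerHypothesis N K)
    (hP : WeierstrassCurve.Affine.Point.map ι.toRatAlgHom P = heegnerPointComplex Dt H)
    (hnt : ¬ IsOfFinAddOrder P) (hodd : Odd (NumberField.discr K))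
    (hI : SchneiderFree.IndexLowerBoundLeAt W 3 K P (padicValNat 3 Dt.c.natAbs)) :
    Koly.Minf Dt H.β ι 3 ≤ ((padicValNat 3 W.tamagawaProduct + padicValNat 3 Dt.c.natAbs : ℕ) : ℕ∞) := by
  subst hN
  haveI hp3 : Fact (Nat.Prime 3) := ⟨Nat.prime_three⟩
  obtain ⟨hCM, hirr, hd3, hd4, hfin, hsha, d₁, M₀, hPd, hdiv, hndiv, hidx⟩ :=
    fhFrame hKo W K Dt H ι P hO6 hsurj hK hHH hP hnt hodd
  haveI : Finite (W.baseChange K).sha := hfin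
  by_contra hlt
  -- `M_∞ ≥ t + s + 1`: global divisibility to depth `t + s + 1`
  have hge : ((padicValNat 3 W.tamagawaProduct + padicValNat 3 Dt.c.natAbs + 1 : ℕ) : ℕ∞) ≤ Koly.Minf Dt H.β ι 3 := by
    rw [Nat.cast_succ]
    exact Order.add_one_le_of_lt (not_le.mp hlt)
  have hglob := (Koly.globalDivisibility_iff_le_minf Dt H.β ι 3 _).mpr hge
  -- Matar–Nekovář Thm. 0.7, global-divisibility (upper) form
  have hbound := hMNU W hCM K hK hd3 hd4 hHH 3 (by decide) hirr Dt H.β ι d₁ P hPd hnt M₀ hdiv hndiv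
    (padicValNat 3 W.tamagawaProduct + padicValNat 3 Dt.c.natAbs + 1)
    (fun s hs n d hn hℓ ↦ hglob s hs n d hn hℓ)
  unfold SchneiderFree.IndexLowerBoundLeAt at hI
  rw [hidx, hsha] at hI
  omega

/-- **`I_FH ⟺ M_∞ ≤ ord₃∏c_ℓ + v₃(c)` at ONE Friedberg–Hoffstein datum of the cell** (§1, both directions), modulo Kolyvagin and
Matar–Nekovář 2019 Thm. 0.7 (both readings, irreducible image, no reduction binder, NO tower) — K0⋆ of the x11b3 cell on the wild cell
and on print. CONDITIONAL; nothing asserted about any curve. [cite: MatarNekovar2019, Thm. 0.7 (p. 456) and §0.11 (p. 457)]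
[cite: McCallumLMS1991, §5 Cor. 5.6 (p. 310)] -/
theorem indexLowerBoundLeAt_FH_iff_minf_le
    (hKo : ∀ (N : ℕ) [NeZero N] (W : WeierstrassCurve ℚ) (K : Type) [Field K] [NumberField K], kolyvagin N W K)
    (hMNL : MatarNekovar2019.thm07_pow_dvd_card_sha_primary_of_certificate_of_irreducible)
    (hMNU : MatarNekovar2019.thm07_padicValNat_card_sha_primary_add_le_of_globalDivisibility_of_irreducible)
    (W : WeierstrassCurve ℚ) [W.IsElliptic] [W.IsGloballyMinimal] (N : ℕ) [NeZero N]
    (K : Type) [Field K] [NumberField K]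
    (Dt : ModularParametrizationData W N) (H : HeegnerDatum N (NumberField.discr K)) (ι : K →+* ℂ)
    (P : (W.baseChange K).toAffine.Point)
    (hO6 : Additive.ClassO6 W 3) (hsurj : W.HasSurjectiveModNGaloisRep 3) (hN : W.conductorNorm ℤ = N)
    (hK : IsImaginaryQuadratic K) (hHH : SatisfiesHeegnerHypothesis N K)
    (hP : WeierstrassCurve.Affine.Point.map ι.toRatAlgHom P = heegnerPointComplex Dt H)
    (hnt : ¬ IsOfFinAddOrder P) (hodd : Odd (NumberField.discr K)) :
    SchneiderFree.IndexLowerBoundLeAt W 3 K P (padicValNat 3 Dt.c.natAbs) ↔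
      Koly.Minf Dt H.β ι 3 ≤ ((padicValNat 3 W.tamagawaProduct + padicValNat 3 Dt.c.natAbs : ℕ) : ℕ∞) :=
  ⟨minf_le_of_indexLowerBoundLeAt_FH hKo hMNU W N K Dt H ι P hO6 hsurj hN hK hHH hP hnt hodd,
    indexLowerBoundLeAt_FH_of_minf_le hKo hMNL W N K Dt H ι P hO6 hsurj hN hK hHH hP hnt hodd⟩

/-- **`I_FH` at a datum FORCES a Kolyvagin certificate of level `≤ ord₃∏c_ℓ + v₃(c) + 1`** (§1 ⟹ plus attainment): some `u ≤ t + s` with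
`Koly.CertificateAt Dt H.β ι 3 u`. So the certificate statements of p621234 / p623400 are not stronger than the crux at the datum (up to the
level shift `u ≤ t + s`). CONDITIONAL on `hKo`, `hMNU`. [cite: MatarNekovar2019, Thm. 0.7 (p. 456)] [cite: McCallumLMS1991, §5 (p. 303), M_r] -/
theorem exists_certificateAt_of_indexLowerBoundLeAt_FH
    (hKo : ∀ (N : ℕ) [NeZero N] (W : WeierstrassCurve ℚ) (K : Type) [Field K] [NumberField K], kolyvagin N W K)
    (hMNU : MatarNekovar2019.thm07_padicValNat_card_sha_primary_add_le_of_globalDivisibility_of_irreducible)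
    (W : WeierstrassCurve ℚ) [W.IsElliptic] [W.IsGloballyMinimal] (N : ℕ) [NeZero N]
    (K : Type) [Field K] [NumberField K]
    (Dt : ModularParametrizationData W N) (H : HeegnerDatum N (NumberField.discr K)) (ι : K →+* ℂ)
    (P : (W.baseChange K).toAffine.Point)
    (hO6 : Additive.ClassO6 W 3) (hsurj : W.HasSurjectiveModNGaloisRep 3) (hN : W.conductorNorm ℤ = N)
    (hK : IsImaginaryQuadratic K) (hHH : SatisfiesHeegnerHypothesis N K)
    (hP : WeierstrassCurve.Affine.Point.map ι.toRatAlgHom P = heegnerPointComplex Dt H)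
    (hnt : ¬ IsOfFinAddOrder P) (hodd : Odd (NumberField.discr K))
    (hI : SchneiderFree.IndexLowerBoundLeAt W 3 K P (padicValNat 3 Dt.c.natAbs)) :
    ∃ u : ℕ, u ≤ padicValNat 3 W.tamagawaProduct + padicValNat 3 Dt.c.natAbs ∧ Koly.CertificateAt Dt H.β ι 3 u := by
  have hmin := minf_le_of_indexLowerBoundLeAt_FH hKo hMNU W N K Dt H ι P hO6 hsurj hN hK hHH hP hnt hodd hI
  have htop : Koly.Minf Dt H.β ι 3 ≠ ⊤ := ne_top_of_le_ne_top (ENat.coe_ne_top _) hmin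
  obtain ⟨u, hu⟩ := ENat.ne_top_iff_exists.mp htop
  refine ⟨u, ?_, Koly.certificateAt_of_minf_eq Dt H.β ι 3 hu.symm⟩
  rw [← hu] at hmin
  exact_mod_cast hmin

/-! ### §2 Class-wide: `E_𝟙^V ⟺ RKC₃^FH,≤` modulo print -/

/-- **`Kolyvagin → Matar–Nekovář (lower) → RKC₃^FH,≤ → WildSplitEisensteinValueAtOneV`.** Hypotheses: Kolyvagin's theorem (`hKo`, named
fact); Matar–Nekovář 2019 Thm. 0.7, certificate form (`hMNL`, named Literature fact); `RKC₃^FH,≤` DISPLAYED — at every datum of the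
registered stub's binders, McCallum's `M_∞(Dt, H.β, ι; 3) ≤ ord₃∏c_ℓ(E) + v₃(c(Dt))`. Conclusion: crux #2″ BY NAME (§1 ⟸, then p632995
`valueAtOneV_of_indexLowerBoundFH_of_kolyvagin`, whose Poitou–Tate / control inputs are tree theorems). CONDITIONAL; nothing asserted
about any curve; closes nothing. [cite: MatarNekovar2019, Thm. 0.7 (p. 456) and §0.11 (p. 457)] [cite: Kolyvagin1990, Thm. A]
[cite: JetchevSkinnerWan2017, Thm. 3.3.1 and §7.4.1 (arXiv:1512.06894 pp. 11, 30)] -/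
theorem valueAtOneV_of_minfLeFH_of_kolyvagin
    (hKo : ∀ (N : ℕ) [NeZero N] (W : WeierstrassCurve ℚ) (K : Type) [Field K] [NumberField K], kolyvagin N W K)
    (hMNL : MatarNekovar2019.thm07_pow_dvd_card_sha_primary_of_certificate_of_irreducible)
    (hR : ∀ (W : WeierstrassCurve ℚ) [W.IsElliptic] [W.IsGloballyMinimal] (N : ℕ) [NeZero N] (K : Type) [Field K]
      [NumberField K] (Dt : ModularParametrizationData W N) (H : HeegnerDatum N (NumberField.discr K)) (ι : K →+* ℂ)
      (P : (W.baseChange K).toAffine.Point), ClassO6 W 3 → W.HasSurjectiveModNGaloisRep 3 → W.analyticRank = 1 →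
      W.conductorNorm ℤ = N → IsImaginaryQuadratic K → SatisfiesHeegnerHypothesis N K →
      (W.quadraticTwist (NumberField.discr K : ℚ)).entireLFunction 1 ≠ 0 →
      WeierstrassCurve.Affine.Point.map ι.toRatAlgHom P = heegnerPointComplex Dt H → ¬ IsOfFinAddOrder P →
      Odd (NumberField.discr K) →
      Koly.Minf Dt H.β ι 3 ≤ ((padicValNat 3 W.tamagawaProduct + padicValNat 3 Dt.c.natAbs : ℕ) : ℕ∞)) :
    WildSplitEisensteinValueAtOneV :=
  WildSplitEisensteinValueAtOneVIndexKolyvagin.valueAtOneV_of_indexLowerBoundFH_of_kolyvagin hKo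
    fun W _ _ N _ K _ _ Dt H ι P hO6 hsurj hr hN hK hHH hLt hP hnt hodd ↦
      indexLowerBoundLeAt_FH_of_minf_le hKo hMNL W N K Dt H ι P hO6 hsurj hN hK hHH hP hnt hodd
        (hR W N K Dt H ι P hO6 hsurj hr hN hK hHH hLt hP hnt hodd)

/-- **`PublishedInputsWildThree → WildSplitPrintedInputsAtThree → Matar–Nekovář (upper) → WildSplitEisensteinValueAtOneV → RKC₃^FH,≤`** —
necessity of the `M_∞` bound (p632342 `indexLowerBoundFH_of_valueAtOneV`, then §1 ⟹ with Kolyvagin = PUB's second conjunct). CONDITIONAL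
on every listed package; nothing asserted about any curve. [cite: MatarNekovar2019, Thm. 0.7 (p. 456) and §0.11 (p. 457)]
[cite: JetchevSkinnerWan2017, Thm. 3.3.1 and §7.4.1 (arXiv:1512.06894 pp. 11, 30)] -/
theorem minfLeFH_of_valueAtOneV (hF : PublishedInputsWildThree) (hW : WildSplitPrintedInputsAtThree)
    (hMNU : MatarNekovar2019.thm07_padicValNat_card_sha_primary_add_le_of_globalDivisibility_of_irreducible)
    (hE1V : WildSplitEisensteinValueAtOneV) :
    ∀ (W : WeierstrassCurve ℚ) [W.IsElliptic] [W.IsGloballyMinimal] (N : ℕ) [NeZero N] (K : Type) [Field K] [NumberField K]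
      (Dt : ModularParametrizationData W N) (H : HeegnerDatum N (NumberField.discr K)) (ι : K →+* ℂ) (P : (W.baseChange K).toAffine.Point),
      ClassO6 W 3 → W.HasSurjectiveModNGaloisRep 3 → W.analyticRank = 1 → W.conductorNorm ℤ = N → IsImaginaryQuadratic K →
      SatisfiesHeegnerHypothesis N K → (W.quadraticTwist (NumberField.discr K : ℚ)).entireLFunction 1 ≠ 0 →
      WeierstrassCurve.Affine.Point.map ι.toRatAlgHom P = heegnerPointComplex Dt H → ¬ IsOfFinAddOrder P → Odd (NumberField.discr K) →
      Koly.Minf Dt H.β ι 3 ≤ ((padicValNat 3 W.tamagawaProduct + padicValNat 3 Dt.c.natAbs : ℕ) : ℕ∞) :=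
  fun W _ _ N _ K _ _ Dt H ι P hO6 hsurj hr hN hK hHH hLt hP hnt hodd ↦
    minf_le_of_indexLowerBoundLeAt_FH hF.2.1 hMNU W N K Dt H ι P hO6 hsurj hN hK hHH hP hnt hodd
      (WildSplitEisensteinValueAtOneVPTFree.indexLowerBoundFH_of_valueAtOneV hF hW hE1V W N K Dt H ι P hO6 hsurj hr
        hN hK hHH hLt hP hnt hodd)

/-- **Modulo PRINT ONLY ({`PublishedInputsWildThree`, `WildSplitPrintedInputsAtThree`, Matar–Nekovář 2019 Thm. 0.7 in both readings}):
`E_𝟙^V ↔ RKC₃^FH,≤`.** Crux #2″ is, binder for binder, the `≤`-half of the refined Kolyvagin conjecture at the wild `3` on the O6 onto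
`r₁` cell — at every odd Friedberg–Hoffstein datum `M_∞ ≤ ord₃(c·∏c_ℓ)`, a statement about the `3`-divisibility of derived HEEGNER POINTS
only. An equivalence between OPEN statements; nothing asserted about any curve; closes nothing. [cite: MatarNekovar2019, Thm. 0.7 (p. 456) and §0.11 (p. 457)]
[cite: McCallumLMS1991, §5 Cor. 5.6 (p. 310)] [cite: WZhang2014, Thm. 1.1, Remark 18 and Thm. 10.2] [cite: JetchevSkinnerWan2017, §7.4.1] -/
theorem valueAtOneV_iff_minfLeFH (hF : PublishedInputsWildThree) (hW : WildSplitPrintedInputsAtThree)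
    (hMNL : MatarNekovar2019.thm07_pow_dvd_card_sha_primary_of_certificate_of_irreducible)
    (hMNU : MatarNekovar2019.thm07_padicValNat_card_sha_primary_add_le_of_globalDivisibility_of_irreducible) :
    WildSplitEisensteinValueAtOneV ↔
    ∀ (W : WeierstrassCurve ℚ) [W.IsElliptic] [W.IsGloballyMinimal] (N : ℕ) [NeZero N] (K : Type) [Field K] [NumberField K]
      (Dt : ModularParametrizationData W N) (H : HeegnerDatum N (NumberField.discr K)) (ι : K →+* ℂ) (P : (W.baseChange K).toAffine.Point),
      ClassO6 W 3 → W.HasSurjectiveModNGaloisRep 3 → W.analyticRank = 1 → W.conductorNorm ℤ = N → IsImaginaryQuadratic K →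
      SatisfiesHeegnerHypothesis N K → (W.quadraticTwist (NumberField.discr K : ℚ)).entireLFunction 1 ≠ 0 →
      WeierstrassCurve.Affine.Point.map ι.toRatAlgHom P = heegnerPointComplex Dt H → ¬ IsOfFinAddOrder P → Odd (NumberField.discr K) →
      Koly.Minf Dt H.β ι 3 ≤ ((padicValNat 3 W.tamagawaProduct + padicValNat 3 Dt.c.natAbs : ℕ) : ℕ∞) :=
  ⟨minfLeFH_of_valueAtOneV hF hW hMNU, valueAtOneV_of_minfLeFH_of_kolyvagin hF.2.1 hMNL⟩

/-! ### §3 The rung in `M_∞` currency -/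

/-- **Modulo the route's remaining `closes` content {PUB 20389, Prims 25896, J‴ 25898, W 24476, Z 20387} and Matar–Nekovář Thm. 0.7
(both readings): `WAllExclAddWildRankOneSurj ↔ RKC₃^FH,≤`** (p632342 `wAllExclAddWildRankOneSurj_iff_valueAtOneV_of_binders` ∘ §2).
CONDITIONAL on every listed package; BSD₃ is proved for no curve. [cite: MatarNekovar2019, Thm. 0.7 (p. 456)]
[cite: JetchevSkinnerWan2017, §7.4.1 (arXiv:1512.06894 p. 30)] [cite: Jetchev2008, Thm. 1.4] -/
theorem wAllExclAddWildRankOneSurj_iff_minfLeFH_of_binders (hF : PublishedInputsWildThree)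
    (hPr : KolyvaginPrimitivesAtThree) (hJ : WildSigmaDivisibilityAtThreeMultiCarrier) (hW : WildSplitPrintedInputsAtThree)
    (hZ : WildRankZeroTwistAtThree)
    (hMNL : MatarNekovar2019.thm07_pow_dvd_card_sha_primary_of_certificate_of_irreducible)
    (hMNU : MatarNekovar2019.thm07_padicValNat_card_sha_primary_add_le_of_globalDivisibility_of_irreducible) :
    Summit.BirchSwinnertonDyer.WAllExclAddWildRankOneSurj ↔
    ∀ (W : WeierstrassCurve ℚ) [W.IsElliptic] [W.IsGloballyMinimal] (N : ℕ) [NeZero N] (K : Type) [Field K] [NumberField K]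
      (Dt : ModularParametrizationData W N) (H : HeegnerDatum N (NumberField.discr K)) (ι : K →+* ℂ) (P : (W.baseChange K).toAffine.Point),
      ClassO6 W 3 → W.HasSurjectiveModNGaloisRep 3 → W.analyticRank = 1 → W.conductorNorm ℤ = N → IsImaginaryQuadratic K →
      SatisfiesHeegnerHypothesis N K → (W.quadraticTwist (NumberField.discr K : ℚ)).entireLFunction 1 ≠ 0 →
      WeierstrassCurve.Affine.Point.map ι.toRatAlgHom P = heegnerPointComplex Dt H → ¬ IsOfFinAddOrder P → Odd (NumberField.discr K) →
      Koly.Minf Dt H.β ι 3 ≤ ((padicValNat 3 W.tamagawaProduct + padicValNat 3 Dt.c.natAbs : ℕ) : ℕ∞) :=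
  (WildSplitEisensteinValueAtOneVPTFree.wAllExclAddWildRankOneSurj_iff_valueAtOneV_of_binders hF hPr hJ hW hZ).trans
    (valueAtOneV_iff_minfLeFH hF hW hMNL hMNU)

/-! ### §4 SOED's two research cruxes pin `M_∞` -/

/-- **`E_𝟙^V ∧ J‴ ⟹ M_∞ = ord₃∏c_ℓ + v₃(c)` EXACTLY on every cut multi-carrier frame of the cell** — the refined Kolyvagin conjecture at the
wild `3` with the Manin slack: `≤` is crux #2″ through §2 (print {PUB, W, MN19-upper}); `≥` is the Kolyvagin column's crux J‴ (item 25898)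
through the refuter's definitions-only bridge `…Negative.le_minf_of_wildSigmaDivisibilityAtThreeMultiCarrier` (`d_K ≠ −3` is automatic, §0).
CONDITIONAL on both OPEN cruxes and the packages; nothing asserted about any curve. [cite: WZhang2014, Remark 18 and Thm. 10.2]
[cite: Jetchev2008, Conj. 1.3] [cite: McCallumLMS1991, §5 Cor. 5.6 (p. 310)] [cite: MatarNekovar2019, Thm. 0.7 (p. 456)] -/
theorem minf_eq_of_valueAtOneV_of_sigmaMultiCarrier (hF : PublishedInputsWildThree) (hW : WildSplitPrintedInputsAtThree)
    (hMNU : MatarNekovar2019.thm07_padicValNat_card_sha_primary_add_le_of_globalDivisibility_of_irreducible)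
    (hE1V : WildSplitEisensteinValueAtOneV) (hJ : WildSigmaDivisibilityAtThreeMultiCarrier)
    (W : WeierstrassCurve ℚ) [W.IsElliptic] [W.IsGloballyMinimal] (N : ℕ) [NeZero N]
    (K : Type) [Field K] [NumberField K]
    (Dt : ModularParametrizationData W N) (H : HeegnerDatum N (NumberField.discr K)) (ι : K →+* ℂ)
    (P : (W.baseChange K).toAffine.Point)
    (hO6 : Additive.ClassO6 W 3) (hsurj : W.HasSurjectiveModNGaloisRep 3) (hr : W.analyticRank = 1) (hN : W.conductorNorm ℤ = N)
    (hK : IsImaginaryQuadratic K) (hHH : SatisfiesHeegnerHypothesis N K)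
    (hLt : (W.quadraticTwist (NumberField.discr K : ℚ)).entireLFunction 1 ≠ 0)
    (hP : WeierstrassCurve.Affine.Point.map ι.toRatAlgHom P = heegnerPointComplex Dt H)
    (hnt : ¬ IsOfFinAddOrder P) (hodd : Odd (NumberField.discr K))
    (hcut : ∀ (q : ℕ) [Fact q.Prime], q ∣ N →
      padicValNat 3 ((W.baseChange ℚ_[q]).localTamagawaNumber ℤ_[q]) < padicValNat 3 W.tamagawaProduct + padicValNat 3 Dt.c.natAbs) :
    Koly.Minf Dt H.β ι 3 = ((padicValNat 3 W.tamagawaProduct + padicValNat 3 Dt.c.natAbs : ℕ) : ℕ∞) := by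
  have hd3 : NumberField.discr K ≠ -3 := by
    subst hN
    exact (fhFrame hF.2.1 W K Dt H ι P hO6 hsurj hK hHH hP hnt hodd).2.2.1
  exact le_antisymm (minfLeFH_of_valueAtOneV hF hW hMNU hE1V W N K Dt H ι P hO6 hsurj hr hN hK hHH hLt hP hnt hodd)
    (WildSigmaDivisibilityAtThreeMultiCarrier.Negative.le_minf_of_wildSigmaDivisibilityAtThreeMultiCarrier hJ W N K Dt H ι P
      hO6 hsurj hr hN hK hHH hLt hP hnt hodd hd3 hcut)

end Summit.BirchSwinnertonDyer.BirchSwinnertonDyer.Theorems.WildSplitEisensteinValueAtOneVMinfCurrency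

end
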